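import Mathlib
import Literature.NumberTheory.Congruences.ZolotarevLemmaJacobi
import Literature.Combinatorics.Enumerative.DeterminantAsPfaffian
import HarnessLib

/-!
# Zolotarev reciprocity: the second Zolotarev lemma, `(a/b)(b/a) = sign Z`, and Zolotarev's proof of the quadratic
# reciprocity law for the Jacobi symbol (Brunyate–Clark, *Extending the Zolotarev–Frobenius approach to quadratic
# reciprocity*, §1.1 Lemma 1.3, §2.2 Lemma 2.2, §2.5 Theorem 2.8, §2.6 Theorem 2.9, §3.1 Theorem 3.1 — for `R = ℤ`)

Layer `Literature/NumberTheory/Congruences`, namespace `Literature.NumberTheory.Congruences.Zolotarev`; lane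
`lit-hodgefound` (Track 2 foundations library), prover seat `lit-hodgefound-p06`, generation 49, self-proposed row g49-#4.
Theorems only: no definition, no instance, no notation, no named fact. Sequel of `ZolotarevLemma.lean` (Lemma 2.5, the
first Zolotarev lemma) and `ZolotarevLemmaJacobi.lean` (g49-#1: `zolotarev_jacobiSym`, `[a/n] = (a/n)` for odd `n`), using the
tree's `Pfaffian.cast_sign_eq_neg_one_pow` (`sign = (−1)^{#inversions}`) and `Pfaffian.card_filter_fst_lt_snd`.

## Source, verbatim ([BrunyateClark2014], held `paper:doi-10-1007-s11139-014-9635-y`, pp. 6, 10, 13–14)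

**Lemma 1.3 (Product Lemma).** "Let `X_1, …, X_r` be nonempty finite sets, with `n_i = #X_i`. Put `X = ∏ X_i` … `P : ∏ Sym X_i →
Sym X` … a) `ϵ(P(σ)) = ∏ ϵ(σ_i)^{n/n_i}`. b) In particular if each `n_i` is odd, then `ϵ(P(σ)) = ∏ ϵ(σ_i)`."
**Lemma 2.2.** "Let `n` be the order of `a` in `(r, +)`. a) `ϵ(s_a) = (−1)^{(n−1)#r/n}`. b) Since `n | #r`, `ϵ(s_a) = 1` if
`#r` is odd" (`s_a : x ↦ x + a`). §2.5: "Let `π : R/(ab) → R/(a) × R/(b)` be the Chinese Remainder Theorem isomorphism. …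
Choose coset representatives `x_0, …, x_{|a|−1}` for `(a)` in `R` and `y_0, …, y_{|b|−1}` for `(b)` … We may therefore define
permutations `α ∈ Sym(R/(a) × R/(b))`, `(x_i mod a, y_j mod b) ↦ (bx_i + y_j mod a, y_j mod b)` and `β`,
`(x_i mod a, y_j mod b) ↦ (x_i mod a, x_i + ay_j mod b)`. … `A = π^{−1} ∘ α ∘ π`, `B = π^{−1} ∘ β ∘ π ∈ Sym(R/(ab))`, and finally
`Z = B ∘ A^{−1} ∈ Sym(R/(ab))`, `bx_i + y_j mod ab ↦ x_i + ay_j mod ab`.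
**Theorem 2.8 (Second Zolotarev Lemma).** For `a, b` coprime odd elements of `R`, `ϵ(A) = [b / R/(a)]`, `ϵ(B) = [a / R/(b)]`.
Proof. Note that `ϵ(A) = ϵ(α)` and `ϵ(B) = ϵ(β)`. Now `α = α_2 ∘ α_1`, where `α_1(x_i, y_j) = (bx_i, y_j)`,
`α_2(x_i, y_j) = (x_i + y_j, y_j)`. Since `|b|` is odd, by Lemma 1.3 `ϵ(α_1) = [b / R/(a)]`. The permutation `α_2` is the direct
sum of the permutations `α_{2,j} : (x, y_j) ↦ (x + y_j, y_j)` on `R/(a) × {y_j}` … By Lemma 2.2, `ϵ(α_{2,j}) = 1` for all `j`. …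
A very similar argument gives `ϵ(B) = ϵ(β) = [a / R/(b)]`." §2.6: "we define the Zolotarev signature `z(a, b) = ϵ(Z) ∈ {±1}`.
**Theorem 2.9 (Zolotarev Reciprocity).** Let `a` and `b` be coprime odd elements in an abstract number ring `R`. Then
`(a/b)(b/a) = z(a, b)`. Proof. … `z(a, b) = ϵ(B ∘ A^{−1}) = ϵ(A) · ϵ(B) = [a/R/(b)][b/R/(a)] = (a/b)(b/a)`."
§3.1: "We shall use `[0, c − 1]` as a set of coset representatives for `ℤ/(c)`. Let `a, b ∈ ℤ^+` be coprime. For all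
`(i, j) ∈ [0, a − 1] × [0, b − 1]`, we have `0 ≤ bi + j, i + aj ≤ n − 1`, so `Z(bi + j) = i + aj`. … so a pair
`(m, m′) = (bi + j, bi′ + j′) ∈ [0, ab − 1]^2` is an inversion for `Z` iff … `i < i′`, `j′ < j`. So the number of inversions is
`C(a,2) C(b,2) = a(a−1)b(b−1)/4`. Thus we get `z(a, b) = (−1)^{(a−1)(b−1)/4}` when `a` and `b` are both odd. This computation
along with Theorem 2.9 yields the following result. **Theorem 3.1 (Jacobi).** For coprime odd `a, b ∈ ℤ^+`, we have
`(a/b)(b/a) = (−1)^{(a−1)(b−1)/4}`."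

## What is typed (`R = ℤ`, representatives `[0, a−1] = Fin a`, `[0, b−1] = Fin b`)

The permutation `Z` of `[0, ab − 1] = Fin (a·b)`, `bi + j ↦ i + aj`, is Mathlib's
`finProdFinEquiv.symm.trans ((Equiv.prodComm _ _).trans (finProdFinEquiv.trans (finCongr (Nat.mul_comm b a))))`
(`finProdFinEquiv (i, j) = j + b·i`).
* §1 Lemma 2.2 (b) in the form used: `sign_eq_one_of_pow_odd_eq_one`, `sign_toPerm_self_eq_one_of_odd_card`,
  `sign_addRight_eq_one_of_odd_card` — translations of a group of odd order are even permutations;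
* §2 §3.1's inversion count `card_inversions_zolotarevZ` (`#inv(Z) = C(a,2)·C(b,2)`, all `a, b`) and
  `sign_zolotarevZ` (`sign Z = (−1)^{C(a,2) C(b,2)}`), `neg_one_pow_choose_two_mul_choose_two` (`= (−1)^{((a−1)/2)((b−1)/2)}` for
  odd `a, b`);
* §3 `exists_equiv_crt` (the Chinese-remainder bijection `π : [0, ab−1] → ℤ/a × ℤ/b`), `exists_equiv_prod_fin` (the
  representatives `[0, a−1] × [0, b−1]` of `ℤ/a × ℤ/b`), THEOREM 2.8 for `ℤ`: `sign_zolotarevAlpha` (`ϵ(α) = (b/a)`) and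
  `sign_zolotarevBeta` (`ϵ(β) = (a/b)`), where `α : (x_i, y_j) ↦ (bx_i + y_j, y_j)` is realised on `ℤ/a × ℤ/b` as
  representatives ∘ `finProdFinEquiv` ∘ `π`, and `β : (x_i, y_j) ↦ (x_i, x_i + ay_j)` likewise; THEOREM 2.9
  **`zolotarev_reciprocity`** (`(a/b)(b/a) = sign Z` for coprime odd `a, b`); THEOREM 3.1 `jacobiSym_mul_jacobiSym`
  (`(a/b)(b/a) = (−1)^{((a−1)/2)((b−1)/2)}` — the quadratic reciprocity law for the Jacobi symbol by Zolotarev's route;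
  Mathlib's own statement is `jacobiSym.quadratic_reciprocity`, proved there via Gauss sums).

## References

* [BrunyateClark2014] A. Brunyate, P. L. Clark, *Extending the Zolotarev–Frobenius approach to quadratic reciprocity*,
  Ramanujan J. 37 (2015) 25–50, Lemma 1.3, Lemma 2.2, Theorems 2.8, 2.9, 3.1.
* [Lemmermeyer2021] F. Lemmermeyer, *Quadratic Number Fields*, Springer (2021), §3.2.4 (Zolotarev's lemma for the Jacobi
  symbol, `ZolotarevLemmaJacobi.lean`).
-/

namespace Literature.NumberTheory.Congruences.Zolotarev

open Equiv Equiv.Perm Finset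

/-! ### §1 Lemma 2.2 (b): translations of a group of odd order are even -/

/-- A permutation with `σ^n = 1` for some odd `n` is even (`ϵ(σ)^n = 1` in `{±1}`).
[cite: BrunyateClark2014, §2.2 Lemma 2.2 (b) (proof via Thm. 1.4)] -/
theorem sign_eq_one_of_pow_odd_eq_one {α : Type*} [Fintype α] [DecidableEq α] {σ : Perm α} {n : ℕ} (hn : Odd n)
    (h : σ ^ n = 1) : Perm.sign σ = 1 := by
  have h1 : ((Perm.sign σ : ℤˣ) : ℤ) ^ n = 1 := by
    rw [← Units.val_pow_eq_pow_val, ← map_pow, h, map_one, Units.val_one]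
  have h2 := units_int_pow_of_odd (Perm.sign σ) hn
  rw [h1] at h2
  exact Units.val_eq_one.mp h2.symm

/-- **Lemma 2.2 (b) / Theorem 1.4**: in a finite group of ODD order every translation `x ↦ g x` is an even permutation.
[cite: BrunyateClark2014, §1.1 Thm. 1.4 (b) and §2.2 Lemma 2.2 (b)] -/
theorem sign_toPerm_self_eq_one_of_odd_card {G : Type*} [Group G] [Fintype G] [DecidableEq G]
    (hG : Odd (Fintype.card G)) (g : G) : Perm.sign (MulAction.toPerm g : Perm G) = 1 := by
  refine sign_eq_one_of_pow_odd_eq_one hG ?_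
  change (MulAction.toPermHom G G g) ^ Fintype.card G = 1
  rw [← map_pow, pow_card_eq_one, map_one]

/-- **Lemma 2.2 (b)** "`ϵ(s_a) = 1` if `#r` is odd", `s_a : x ↦ x + a`: a translation of an additive group of odd order is an
even permutation. [cite: BrunyateClark2014, §2.2 Lemma 2.2 (b)] -/
theorem sign_addRight_eq_one_of_odd_card {A : Type*} [AddGroup A] [Fintype A] [DecidableEq A]
    (hA : Odd (Fintype.card A)) (c : A) : Perm.sign (Equiv.addRight c) = 1 :=
  sign_eq_one_of_pow_odd_eq_one hA (by rw [Equiv.nsmul_addRight, card_nsmul_eq_zero, Equiv.addRight_zero])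

/-! ### §2 The Zolotarev permutation `Z : bi + j ↦ i + aj` of `[0, ab − 1]` and its inversions (§3.1) -/

/-- "`bi + j < bi′ + j′ ⟺ (i < i′) or (i = i′ and j < j′)`" for `j, j′ < b`. [cite: BrunyateClark2014, §3.1] -/
theorem add_mul_lt_add_mul_iff_lex {b i i' j j' : ℕ} (hj : j < b) (hj' : j' < b) :
    j + b * i < j' + b * i' ↔ i < i' ∨ (i = i' ∧ j < j') := by
  constructor
  · intro h
    rcases lt_trichotomy i i' with hlt | rfl | hgt
    · exact Or.inl hlt
    · exact Or.inr ⟨rfl, by omega⟩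
    · exfalso
      have h1 : b * (i' + 1) ≤ b * i := Nat.mul_le_mul_left b hgt
      rw [Nat.mul_succ] at h1
      omega
  · rintro (hlt | ⟨rfl, hjj⟩)
    · have h1 : b * (i + 1) ≤ b * i' := Nat.mul_le_mul_left b hlt
      rw [Nat.mul_succ] at h1
      omega
    · omega

/-- `finProdFinEquiv (i, j) = j + b·i` read as "`bi + j`", and `Z(bi + j) = i + aj`: the values of the Zolotarev
permutation. [cite: BrunyateClark2014, §3.1 ("Z(bi + j) = i + aj")] -/
theorem zolotarevZ_apply_val (a b : ℕ) (i : Fin a) (j : Fin b) :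
    (((finProdFinEquiv.symm.trans ((Equiv.prodComm (Fin a) (Fin b)).trans
        (finProdFinEquiv.trans (finCongr (Nat.mul_comm b a))))) : Perm (Fin (a * b)))
        (finProdFinEquiv (i, j)) : ℕ) = i + a * j := by
  simp [finProdFinEquiv_apply_val]

/-- **§3.1: the inversions of `Z` are the pairs `(bi + j, bi′ + j′)` with `i < i′`, `j′ < j`; their number is
`C(a,2)·C(b,2)`** (any `a, b`). [cite: BrunyateClark2014, §3.1] -/
theorem card_inversions_zolotarevZ (a b : ℕ) :
    #(Literature.Combinatorics.Enumerative.Pfaffian.inversions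
        ((finProdFinEquiv.symm.trans ((Equiv.prodComm (Fin a) (Fin b)).trans
          (finProdFinEquiv.trans (finCongr (Nat.mul_comm b a))))) : Perm (Fin (a * b)))) =
      a.choose 2 * b.choose 2 := by
  set Z : Perm (Fin (a * b)) := finProdFinEquiv.symm.trans ((Equiv.prodComm (Fin a) (Fin b)).trans
    (finProdFinEquiv.trans (finCongr (Nat.mul_comm b a)))) with hZ
  set F₁ : Fin a × Fin b ≃ Fin (a * b) := finProdFinEquiv with hF₁
  have hF₁val : ∀ i : Fin a, ∀ j : Fin b, ((F₁ (i, j) : Fin (a * b)) : ℕ) = j + b * i := fun i j => by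
    rw [hF₁, finProdFinEquiv_apply_val]
  have hZval : ∀ i : Fin a, ∀ j : Fin b, ((Z (F₁ (i, j)) : Fin (a * b)) : ℕ) = i + a * j := fun i j => by
    rw [hZ, hF₁]
    exact zolotarevZ_apply_val a b i j
  rw [← Literature.Combinatorics.Enumerative.Pfaffian.card_filter_fst_lt_snd (n := a),
    ← Literature.Combinatorics.Enumerative.Pfaffian.card_filter_fst_lt_snd (n := b), ← card_product]
  symm
  refine card_nbij (fun t : (Fin a × Fin a) × (Fin b × Fin b) => (F₁ (t.1.1, t.2.2), F₁ (t.1.2, t.2.1)))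
    (fun t ht => ?_) (fun t ht t' ht' htt => ?_) (fun q hq => ?_)
  · -- pairs `i < i'`, `j' < j` give inversions
    obtain ⟨⟨i, i'⟩, ⟨j', j⟩⟩ := t
    rw [mem_coe, mem_product, mem_filter, mem_filter] at ht
    obtain ⟨⟨-, hii⟩, ⟨-, hjj⟩⟩ := ht
    rw [Fin.lt_def] at hii hjj
    rw [mem_coe, Literature.Combinatorics.Enumerative.Pfaffian.mem_inversions, Fin.lt_def, Fin.lt_def, hZval, hZval,
      hF₁val, hF₁val]
    exact ⟨(add_mul_lt_add_mul_iff_lex j.2 j'.2).mpr (Or.inl hii), (add_mul_lt_add_mul_iff_lex i'.2 i.2).mpr (Or.inl hjj)⟩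
  · -- injective
    obtain ⟨⟨i, i'⟩, ⟨j', j⟩⟩ := t
    obtain ⟨⟨k, k'⟩, ⟨l', l⟩⟩ := t'
    simp only [Prod.mk.injEq] at htt
    obtain ⟨h1, h2⟩ := htt
    have e1 := F₁.injective h1
    have e2 := F₁.injective h2
    simp only [Prod.mk.injEq] at e1 e2
    rw [e1.1, e1.2, e2.1, e2.2]
  · -- surjective
    obtain ⟨m, m'⟩ := q
    rw [mem_coe, Literature.Combinatorics.Enumerative.Pfaffian.mem_inversions, Fin.lt_def, Fin.lt_def] at hq
    obtain ⟨hlt, hZlt⟩ := hq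
    obtain ⟨⟨i, j⟩, rfl⟩ := F₁.surjective m
    obtain ⟨⟨i', j'⟩, rfl⟩ := F₁.surjective m'
    rw [hF₁val, hF₁val] at hlt
    rw [hZval, hZval] at hZlt
    have h1 := (add_mul_lt_add_mul_iff_lex j.2 j'.2).mp hlt
    have h2 := (add_mul_lt_add_mul_iff_lex i'.2 i.2).mp hZlt
    have hii : (i : ℕ) < i' := by
      rcases h1 with h | ⟨h, h'⟩
      · exact h
      · rcases h2 with h2 | ⟨h2, h2'⟩
        · exfalso
          have : i = i' := Fin.ext h
          subst this
          omega
        · omega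
    have hjj : (j' : ℕ) < j := by
      rcases h2 with h | ⟨h, h'⟩
      · exact h
      · omega
    refine ⟨((i, i'), (j', j)), ?_, rfl⟩
    rw [mem_coe, mem_product, mem_filter, mem_filter, Fin.lt_def, Fin.lt_def]
    exact ⟨⟨mem_univ _, hii⟩, ⟨mem_univ _, hjj⟩⟩

/-- **§3.1: `z(a, b) = sign Z = (−1)^{C(a,2)·C(b,2)}`** (any `a, b`; `= (−1)^{a(a−1)b(b−1)/4}`).
[cite: BrunyateClark2014, §3.1] -/
theorem sign_zolotarevZ (a b : ℕ) :
    ((Perm.sign ((finProdFinEquiv.symm.trans ((Equiv.prodComm (Fin a) (Fin b)).trans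
        (finProdFinEquiv.trans (finCongr (Nat.mul_comm b a))))) : Perm (Fin (a * b))) : ℤˣ) : ℤ) =
      (-1) ^ (a.choose 2 * b.choose 2) := by
  rw [← card_inversions_zolotarevZ a b]
  exact Literature.Combinatorics.Enumerative.Pfaffian.cast_sign_eq_neg_one_pow (R := ℤ) _

/-- "`(−1)^{a(a−1)b(b−1)/4} = (−1)^{(a−1)(b−1)/4}` when `a` and `b` are both odd": for odd `a, b`,
`(−1)^{C(a,2) C(b,2)} = (−1)^{((a−1)/2)((b−1)/2)}`. [cite: BrunyateClark2014, §3.1] -/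
theorem neg_one_pow_choose_two_mul_choose_two {a b : ℕ} (ha : Odd a) (hb : Odd b) :
    (-1 : ℤ) ^ (a.choose 2 * b.choose 2) = (-1) ^ ((a / 2) * (b / 2)) := by
  obtain ⟨s, rfl⟩ := ha
  obtain ⟨t, rfl⟩ := hb
  have hca : (2 * s + 1).choose 2 = s * (2 * s + 1) := by
    rw [Nat.choose_two_right, Nat.add_sub_cancel, show (2 * s + 1) * (2 * s) = 2 * (s * (2 * s + 1)) by ring,
      Nat.mul_div_cancel_left _ two_pos]
  have hcb : (2 * t + 1).choose 2 = t * (2 * t + 1) := by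
    rw [Nat.choose_two_right, Nat.add_sub_cancel, show (2 * t + 1) * (2 * t) = 2 * (t * (2 * t + 1)) by ring,
      Nat.mul_div_cancel_left _ two_pos]
  have hodd : Odd ((2 * s + 1) * (2 * t + 1)) := (odd_two_mul_add_one s).mul (odd_two_mul_add_one t)
  rw [hca, hcb, show (2 * s + 1) / 2 = s by omega, show (2 * t + 1) / 2 = t by omega,
    show s * (2 * s + 1) * (t * (2 * t + 1)) = (2 * s + 1) * (2 * t + 1) * (s * t) by ring, pow_mul,
    hodd.neg_one_pow]

/-! ### §3 Theorem 2.8 (second Zolotarev lemma), Theorem 2.9 (Zolotarev reciprocity), Theorem 3.1 (Jacobi) -/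

/-- **The Chinese-remainder bijection `π : [0, ab−1] → ℤ/a × ℤ/b`, `m ↦ (m mod a, m mod b)`** for coprime `a, b`
("Let `π : R/(ab) → R/(a) × R/(b)` be the Chinese Remainder Theorem isomorphism"). [cite: BrunyateClark2014, §2.5] -/
theorem exists_equiv_crt {a b : ℕ} [NeZero a] [NeZero b] (hab : a.Coprime b) :
    ∃ π : Fin (a * b) ≃ ZMod a × ZMod b, ∀ m : Fin (a * b), π m = (((m : ℕ) : ZMod a), ((m : ℕ) : ZMod b)) := by
  have hinj : Function.Injective
      fun m : Fin (a * b) => ((((m : ℕ) : ZMod a), ((m : ℕ) : ZMod b)) : ZMod a × ZMod b) := by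
    intro m m' h
    simp only [Prod.mk.injEq] at h
    obtain ⟨h1, h2⟩ := h
    rw [ZMod.natCast_eq_natCast_iff] at h1 h2
    have hab' : (m : ℕ) ≡ m' [MOD a * b] := (Nat.modEq_and_modEq_iff_modEq_mul hab).mp ⟨h1, h2⟩
    refine Fin.ext ?_
    rw [Nat.ModEq, Nat.mod_eq_of_lt m.2, Nat.mod_eq_of_lt m'.2] at hab'
    exact hab'
  have hbij : Function.Bijective
      fun m : Fin (a * b) => ((((m : ℕ) : ZMod a), ((m : ℕ) : ZMod b)) : ZMod a × ZMod b) :=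
    (Fintype.bijective_iff_injective_and_card _).mpr ⟨hinj, by simp [ZMod.card]⟩
  exact ⟨Equiv.ofBijective _ hbij, fun _ => rfl⟩

/-- The coset representatives `[0, a−1]`, `[0, b−1]`: a bijection `ℤ/a × ℤ/b ≃ [0, a−1] × [0, b−1]` reading off the least
non-negative residues (`ZMod.finEquiv`). [cite: BrunyateClark2014, §3.1 ("We shall use [0, c − 1] as a set of coset representatives for ℤ/(c)")] -/
theorem exists_equiv_prod_fin (a b : ℕ) [NeZero a] [NeZero b] :
    ∃ E : ZMod a × ZMod b ≃ Fin a × Fin b,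
      ∀ p, (((E p).1 : Fin a) : ℕ) = p.1.val ∧ (((E p).2 : Fin b) : ℕ) = p.2.val := by
  refine ⟨Equiv.prodCongr (ZMod.finEquiv a).symm.toEquiv (ZMod.finEquiv b).symm.toEquiv, fun p => ⟨?_, ?_⟩⟩
  · obtain ⟨k, rfl⟩ := Nat.exists_eq_add_one_of_ne_zero (NeZero.ne a)
    rfl
  · obtain ⟨k, rfl⟩ := Nat.exists_eq_add_one_of_ne_zero (NeZero.ne b)
    rfl

/-- **THEOREM 2.8, first half, for `R = ℤ`: `ϵ(A) = ϵ(α) = [b/a] = (b/a)`.** Here `α = π ∘ F₁` is the permutation of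
`ℤ/a × ℤ/b`, `(x_i, y_j) ↦ (bx_i + y_j mod a, y_j mod b)` (`F₁(i, j) = bi + j` = Mathlib's `finProdFinEquiv` read on the
representatives, `π` the Chinese-remainder bijection); "`α = α_2 ∘ α_1`, `α_1(x, y) = (bx, y)` of sign `[b/a]^{|b|} = [b/a]`
(Lemma 1.3), `α_2(x, y_j) = (x + y_j, y_j)` of sign `1` (Lemma 2.2)". For odd coprime `a, b`.
[cite: BrunyateClark2014, §2.5 Thm. 2.8] -/
theorem sign_zolotarevAlpha {a b : ℕ} [NeZero a] [NeZero b] (ha : Odd a) (hb : Odd b) (hba : b.Coprime a)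
    (π : Fin (a * b) ≃ ZMod a × ZMod b) (hπ : ∀ m : Fin (a * b), π m = (((m : ℕ) : ZMod a), ((m : ℕ) : ZMod b)))
    (E : ZMod a × ZMod b ≃ Fin a × Fin b)
    (hE : ∀ p, (((E p).1 : Fin a) : ℕ) = p.1.val ∧ (((E p).2 : Fin b) : ℕ) = p.2.val) :
    ((Perm.sign (((E.trans finProdFinEquiv).trans π : Perm (ZMod a × ZMod b))) : ℤˣ) : ℤ) = jacobiSym b a := by
  classical
  -- `α = α_2 * α_1`
  have hα : ((E.trans finProdFinEquiv).trans π : Perm (ZMod a × ZMod b)) =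
      (prodCongrLeft fun y : ZMod b => Equiv.addRight ((y.val : ℕ) : ZMod a)) *
        (prodCongrLeft fun _ : ZMod b => (MulAction.toPerm (ZMod.unitOfCoprime b hba) : Perm (ZMod a))) := by
    refine Equiv.ext fun p => ?_
    obtain ⟨x, y⟩ := p
    obtain ⟨h1, h2⟩ := hE (x, y)
    rw [Equiv.trans_apply, Equiv.trans_apply, hπ, finProdFinEquiv_apply_val, h1, h2, Perm.mul_apply,
      prodCongrLeft_apply, prodCongrLeft_apply, Equiv.coe_addRight, MulAction.toPerm_apply, Units.smul_def,
      ZMod.coe_unitOfCoprime, smul_eq_mul]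
    refine Prod.ext ?_ ?_
    · simp only [Nat.cast_add, Nat.cast_mul, ZMod.natCast_zmod_val]
      ring
    · simp only [Nat.cast_add, Nat.cast_mul, ZMod.natCast_zmod_val, ZMod.natCast_self, zero_mul, add_zero]
  have hcard : Odd (Fintype.card (ZMod a)) := by rwa [ZMod.card]
  rw [hα, Perm.sign_mul, sign_prodCongrLeft, sign_prodCongrLeft,
    Finset.prod_eq_one (fun y _ => sign_addRight_eq_one_of_odd_card hcard _), one_mul, Finset.prod_const,
    Finset.card_univ, ZMod.card, Units.val_pow_eq_pow_val, units_int_pow_of_odd _ hb, zolotarev_jacobiSym_nat ha hba]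

/-- **THEOREM 2.8, second half, for `R = ℤ`: `ϵ(B) = ϵ(β) = [a/b] = (a/b)`**, `β = π ∘ F₂ : (x_i, y_j) ↦ (x_i mod a,
x_i + ay_j mod b)` (`F₂(i, j) = i + aj`); "A very similar argument". [cite: BrunyateClark2014, §2.5 Thm. 2.8] -/
theorem sign_zolotarevBeta {a b : ℕ} [NeZero a] [NeZero b] (ha : Odd a) (hb : Odd b) (hab : a.Coprime b)
    (π : Fin (a * b) ≃ ZMod a × ZMod b) (hπ : ∀ m : Fin (a * b), π m = (((m : ℕ) : ZMod a), ((m : ℕ) : ZMod b)))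
    (E : ZMod a × ZMod b ≃ Fin a × Fin b)
    (hE : ∀ p, (((E p).1 : Fin a) : ℕ) = p.1.val ∧ (((E p).2 : Fin b) : ℕ) = p.2.val) :
    ((Perm.sign (((E.trans ((Equiv.prodComm (Fin a) (Fin b)).trans
        (finProdFinEquiv.trans (finCongr (Nat.mul_comm b a))))).trans π : Perm (ZMod a × ZMod b))) : ℤˣ) : ℤ) =
      jacobiSym a b := by
  classical
  -- `β = β_2 * β_1`
  have hβ : ((E.trans ((Equiv.prodComm (Fin a) (Fin b)).trans
        (finProdFinEquiv.trans (finCongr (Nat.mul_comm b a))))).trans π : Perm (ZMod a × ZMod b)) =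
      (prodCongrRight fun x : ZMod a => Equiv.addRight ((x.val : ℕ) : ZMod b)) *
        (prodCongrRight fun _ : ZMod a => (MulAction.toPerm (ZMod.unitOfCoprime a hab) : Perm (ZMod b))) := by
    refine Equiv.ext fun p => ?_
    obtain ⟨x, y⟩ := p
    obtain ⟨h1, h2⟩ := hE (x, y)
    rw [Equiv.trans_apply, Equiv.trans_apply, Equiv.trans_apply, Equiv.trans_apply, hπ, finCongr_apply, Fin.val_cast,
      finProdFinEquiv_apply_val, Equiv.prodComm_apply, Prod.fst_swap, Prod.snd_swap, h1, h2, Perm.mul_apply,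
      prodCongrRight_apply, prodCongrRight_apply, Equiv.coe_addRight, MulAction.toPerm_apply, Units.smul_def,
      ZMod.coe_unitOfCoprime, smul_eq_mul]
    refine Prod.ext ?_ ?_
    · simp only [Nat.cast_add, Nat.cast_mul, ZMod.natCast_zmod_val, ZMod.natCast_self, zero_mul, add_zero]
    · simp only [Nat.cast_add, Nat.cast_mul, ZMod.natCast_zmod_val]
      ring
  have hcard : Odd (Fintype.card (ZMod b)) := by rwa [ZMod.card]
  rw [hβ, Perm.sign_mul, sign_prodCongrRight, sign_prodCongrRight,
    Finset.prod_eq_one (fun x _ => sign_addRight_eq_one_of_odd_card hcard _), one_mul, Finset.prod_const,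
    Finset.card_univ, ZMod.card, Units.val_pow_eq_pow_val, units_int_pow_of_odd _ ha, zolotarev_jacobiSym_nat hb hab]

/-- **THEOREM 2.9 (Zolotarev Reciprocity) for `R = ℤ`**: for coprime odd `a, b ≥ 1`, `(a/b)(b/a) = z(a, b) = sign Z`,
`Z : bi + j ↦ i + aj` the Zolotarev permutation of `[0, ab − 1]` ("`z(a, b) = ϵ(B ∘ A^{−1}) = ϵ(A)·ϵ(B) = (a/b)(b/a)`": here
`Z = F₁^{−1} F₂` is conjugate, under the Chinese-remainder bijection `π`, to `β ∘ α^{−1}` with `α = π F₁`, `β = π F₂` read on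
representatives). [cite: BrunyateClark2014, §2.6 Thm. 2.9] -/
theorem zolotarev_reciprocity {a b : ℕ} (ha : Odd a) (hb : Odd b) (hab : a.Coprime b) :
    jacobiSym a b * jacobiSym b a =
      ((Perm.sign ((finProdFinEquiv.symm.trans ((Equiv.prodComm (Fin a) (Fin b)).trans
        (finProdFinEquiv.trans (finCongr (Nat.mul_comm b a))))) : Perm (Fin (a * b))) : ℤˣ) : ℤ) := by
  classical
  haveI : NeZero a := ⟨ha.pos.ne'⟩
  haveI : NeZero b := ⟨hb.pos.ne'⟩
  obtain ⟨π, hπ⟩ := exists_equiv_crt hab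
  obtain ⟨E, hE⟩ := exists_equiv_prod_fin a b
  -- `Z = F₁⁻¹ F₂` is conjugate under `π` to `β α⁻¹`
  have hconj : Perm.sign ((finProdFinEquiv.symm.trans ((Equiv.prodComm (Fin a) (Fin b)).trans
      (finProdFinEquiv.trans (finCongr (Nat.mul_comm b a))))) : Perm (Fin (a * b))) =
      Perm.sign ((((E.trans ((Equiv.prodComm (Fin a) (Fin b)).trans
          (finProdFinEquiv.trans (finCongr (Nat.mul_comm b a))))).trans π : Perm (ZMod a × ZMod b))) *
        (((E.trans finProdFinEquiv).trans π : Perm (ZMod a × ZMod b)))⁻¹) := by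
    refine sign_eq_sign_of_equiv _ _ π fun m => ?_
    simp only [Equiv.trans_apply, Perm.mul_apply, Perm.inv_def, Equiv.symm_trans_apply, Equiv.symm_apply_apply,
      Equiv.apply_symm_apply]
  rw [hconj, Perm.sign_mul, Perm.sign_inv, Units.val_mul, sign_zolotarevBeta ha hb hab π hπ E hE,
    sign_zolotarevAlpha ha hb hab.symm π hπ E hE]

/-- **THEOREM 3.1 (Jacobi), by Zolotarev's route**: for coprime odd `a, b ≥ 1`, `(a/b)(b/a) = (−1)^{((a−1)/2)((b−1)/2)}`
— Theorem 2.9 combined with the inversion count of §3.1. (Mathlib proves the quadratic reciprocity law for the Jacobi symbol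
as `jacobiSym.quadratic_reciprocity`, via Gauss sums; this is the statement as printed in the source, reached by signatures of
permutations only.) [cite: BrunyateClark2014, §3.1 Thm. 3.1] -/
theorem jacobiSym_mul_jacobiSym {a b : ℕ} (ha : Odd a) (hb : Odd b) (hab : a.Coprime b) :
    jacobiSym a b * jacobiSym b a = (-1) ^ ((a / 2) * (b / 2)) := by
  rw [zolotarev_reciprocity ha hb hab, sign_zolotarevZ, neg_one_pow_choose_two_mul_choose_two ha hb]

end Literature.NumberTheory.Congruences.Zolotarev
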